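import Summits.ResolutionOfSingularities.ResolutionOfSingularities.Theorems.RadicialJungCleanModelsStubParameterSubset
import Mathlib.RingTheory.AdicCompletion.LocalRing
import Mathlib.RingTheory.AdicCompletion.AsTensorProduct
import Mathlib.RingTheory.Flat.FaithfullyFlat.Algebra
import HarnessLib

/-!
# Stub `stub_toroidalUnitDescends` for crux stmt-ResolutionOfSingularities-15917
(`RadicialJung.CleanModels`, line `Sketch`, rev 6)

**A formal unit against an algebraic monomial is an algebraic unit.** Let `O` be a regular local
ring with `𝔪`-adic completion `ι : O → Ô = AdicCompletion 𝔪 O`, `t : Fin d → O` a regular system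
of parameters (`(t) = 𝔪`, `d = dim O`), `a : Fin m → ℕ` exponents (`m ≤ d`) and `s ∈ O` with
`ι s = û · ∏_{i<m} ι(t_i)^{a_i}` for a unit `û` of `Ô`. Then `s = u · ∏_{i<m} t_i^{a_i}` for a
unit `u` of `O`.

Proof. Put `P = ∏_{i<m} t_i^{a_i}`, so `ι s = û · ι P`.
* `P` is a non-zero-divisor of `O`: each `t_j` is `O`-regular, being a one-element part of a
  regular system of parameters (`isWeaklyRegular_ofFn_of_span_eq_maximalIdeal`), and products of
  regular elements are regular.
* `Ô` is faithfully flat over `O` (flat: Mathlib `AdicCompletion.flat_of_isNoetherian`; local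
  structure map: Mathlib instance; `Module.FaithfullyFlat.of_flat_of_isLocalHom`), so
  `P Ô ∩ O = P O` (`Ideal.comap_map_eq_self_of_faithfullyFlat`) and `s = u P` with `u ∈ O`.
* `ι u · ι P = û · ι P` and `ι P` is `Ô`-regular (`IsSMulRegular.of_flat`), so `ι u = û` is a
  unit; `ι` is local, hence `u` is a unit.
-/

noncomputable section

set_option linter.dupNamespace false

open IsLocalRing

namespace Summit.ResolutionOfSingularities.ResolutionOfSingularities.Theorems.RadicialJung.CleanModels

universe u

/-- **Members of a regular system of parameters are non-zero-divisors.** If `t : Fin d → O`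
generates the maximal ideal of a regular local ring `O` of dimension `d`, then every `t j` is
`O`-regular (the one-element sequence `[t j]` is part of a regular system of parameters, hence
weakly regular). -/
theorem isSMulRegular_of_span_eq_maximalIdeal {O : Type u} [CommRing O] [IsRegularLocalRing O]
    {d : ℕ} (t : Fin d → O) (ht : Ideal.span (Set.range t) = maximalIdeal O)
    (hd : ringKrullDim O = (d : WithBot ℕ∞)) (j : Fin d) : IsSMulRegular O (t j) := by
  have h := isWeaklyRegular_ofFn_of_span_eq_maximalIdeal t ht hd (fun _ : Fin 1 => j)
    (Function.injective_of_subsingleton _)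
  rw [List.ofFn_succ, List.ofFn_zero, RingTheory.Sequence.isWeaklyRegular_singleton_iff] at h
  exact h

/-- **A monomial in a regular system of parameters is a non-zero-divisor.** With `t` as in
`isSMulRegular_of_span_eq_maximalIdeal`, `∏_{i<m} t_i^{a_i}` is `O`-regular. -/
theorem isSMulRegular_prod_pow_of_span_eq_maximalIdeal {O : Type u} [CommRing O]
    [IsRegularLocalRing O] {d m : ℕ} (hmd : m ≤ d) (t : Fin d → O)
    (ht : Ideal.span (Set.range t) = maximalIdeal O) (hd : ringKrullDim O = (d : WithBot ℕ∞))
    (a : Fin m → ℕ) : IsSMulRegular O (∏ i : Fin m, t (Fin.castLE hmd i) ^ (a i)) :=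
  Finset.prod_induction _ (IsSMulRegular O) (fun _ _ ha hb => ha.mul hb) (IsSMulRegular.one O)
    fun i _ => (isSMulRegular_of_span_eq_maximalIdeal t ht hd _).pow (a i)

/-- **A formal unit against an algebraic monomial is an algebraic unit.** For a regular local
ring `O` with completion `ι : O → Ô = AdicCompletion (maximalIdeal O) O`, a minimal generating
system `(t_1..t_d)` of `𝔪` (`d = dim O`), exponents `a_i` and `s ∈ O`: if
`ι s = û · ∏_{i<m} ι(t_i)^{a_i}` with `û ∈ Ô^×`, then `s = u · ∏_{i<m} t_i^{a_i}` with `u ∈ O^×`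
(`∏ t_i^{a_i}` is a non-zero-divisor of `O`, `(∏ t_i^{a_i}) Ô ∩ O = (∏ t_i^{a_i}) O` by faithful
flatness of `O → Ô`, flatness transports regularity so `ι u = û`, and `ι` reflects units). -/
theorem stub_toroidalUnitDescends {O : Type u} [CommRing O] [IsRegularLocalRing O]
    {d m : ℕ} (hmd : m ≤ d) (t : Fin d → O)
    (ht : Ideal.span (Set.range t) = maximalIdeal O) (hd : ringKrullDim O = (d : WithBot ℕ∞))
    (a : Fin m → ℕ) (s : O) (û : AdicCompletion (maximalIdeal O) O) (hû : IsUnit û)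
    (hs : algebraMap O (AdicCompletion (maximalIdeal O) O) s =
      û * ∏ i : Fin m,
        algebraMap O (AdicCompletion (maximalIdeal O) O) (t (Fin.castLE hmd i)) ^ (a i)) :
    ∃ u : O, IsUnit u ∧ s = u * ∏ i : Fin m, t (Fin.castLE hmd i) ^ (a i) := by
  -- `P = ∏ t_i^{a_i}` is `O`-regular and `ι s = û · ι P`
  have hreg : IsSMulRegular O (∏ i : Fin m, t (Fin.castLE hmd i) ^ (a i)) :=
    isSMulRegular_prod_pow_of_span_eq_maximalIdeal hmd t ht hd a
  have hsP : algebraMap O (AdicCompletion (maximalIdeal O) O) s =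
      û * algebraMap O (AdicCompletion (maximalIdeal O) O)
        (∏ i : Fin m, t (Fin.castLE hmd i) ^ (a i)) := by
    rw [hs, map_prod]
    simp only [map_pow]
  -- faithful flatness of `O → Ô`: `s ∈ P Ô ∩ O = P O`
  haveI : Module.FaithfullyFlat O (AdicCompletion (maximalIdeal O) O) :=
    Module.FaithfullyFlat.of_flat_of_isLocalHom
  have hmem : s ∈ ((Ideal.span {∏ i : Fin m, t (Fin.castLE hmd i) ^ (a i)}).map
      (algebraMap O (AdicCompletion (maximalIdeal O) O))).comap
        (algebraMap O (AdicCompletion (maximalIdeal O) O)) := by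
    rw [Ideal.mem_comap, Ideal.map_span, Set.image_singleton, Ideal.mem_span_singleton']
    exact ⟨û, hsP.symm⟩
  rw [Ideal.comap_map_eq_self_of_faithfullyFlat, Ideal.mem_span_singleton'] at hmem
  obtain ⟨u, rfl⟩ := hmem
  refine ⟨u, ?_, rfl⟩
  -- `ι u · ι P = û · ι P` with `ι P` regular on `Ô` (flatness): `ι u = û`, and `ι` is local
  have hu : algebraMap O (AdicCompletion (maximalIdeal O) O) u = û := by
    refine hreg.of_flat ?_
    dsimp only
    rw [smul_eq_mul, smul_eq_mul, mul_comm, ← map_mul, hsP, mul_comm]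
  exact IsUnit.of_map (algebraMap O (AdicCompletion (maximalIdeal O) O)) u (hu ▸ hû)

end Summit.ResolutionOfSingularities.ResolutionOfSingularities.Theorems.RadicialJung.CleanModels

end
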